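import Mathlib.Analysis.Complex.ExponentialBounds
import Mathlib.Algebra.Order.Field.GeomSum
import Literature.NumberTheory.LFunctions.RudnickSarnakZeros
import Literature.NumberTheory.LFunctions.PairBoxExchange
import HarnessLib

/-!
# Pair statistics of zeta zeros: Montgomery's normalisation versus `γ̃ = γ log γ / 2π` (proved)

Trunk T-ANT (`Literature/NumberTheory/LFunctions`). Proofs only: no definitions, no named facts.
Companion of `ZeroStatistics.lean` (the named fact `gueHypothesisAt_one_iff_montgomery`:
`GUEHypothesisAt 1 ↔ MontgomeryPairCorrelation`). Montgomery's conjecture (Montgomery 1973,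
(12); Titchmarsh–Heath-Brown §14.34) measures the difference of two ordinates `γ_a, γ_b ≤ T` as
`δ_T = (γ_a − γ_b) log T / 2π`, the Rudnick–Sarnak `2`-level statistics (Duke 81 (1996), §1)
as `δ_G = γ̃_a − γ̃_b`, `γ̃ = γ log γ / 2π` (`normalizedOrdinate`). This file proves that the
closed-box statistics of the off-diagonal pairs of indices `a ≠ b < N(T)` converge in the one
normalisation iff they converge in the other (to `∫_α^β w`, any continuous `0 ≤ w ≤ 1`):
`tendsto_card_normalizedBox_iff_tendsto_card_logBox`. It instantiates the abstract exchange
theorem `PairCount.tendsto_card_filter_Icc_div_of_close` (`PairBoxExchange.lean`) with: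

* closeness (`abs_normalizedDiff_sub_logDiff_le` and the eventual form
  `eventually_close_logDiff_normalizedDiff`): for `T/M < γ_a, γ_b ≤ T`,
  `|δ_G − δ_T| ≤ |δ_T| (log M + 1)/log T`, from
  `(y − x)(log x + 1) ≤ y log y − x log x ≤ (y − x)(log y + 1)` (`mul_log_sub_mul_log_le`,
  `le_mul_log_sub_mul_log`);
* negligibility of the pairs with a small ordinate (`eventually_card_smallPairs_le`): the pairs
  with `min(γ_a, γ_b) ≤ T/2^{m₀}` and `|δ_G| ≤ 3B/2` are `O(1) + O(T log T / 2^{m₀})`, by sorting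
  them into dyadic height blocks `(T'/4, T'/2] ∋ min γ`, `T' = 2T/2^n`, each of which lies in
  the set of pairs below `N(T')` with `|δ_{T'}| ≤ 2B`, `|δ_G| ≤ 2B`, of size `≤ C N(T')`
  (a-priori bound), and summing the geometric series with `N(x) ≤ C₁ x log x`; against
  `N(T) ≥ c T log T` (`eventually_mul_le_zetaZeroCount`) this is an `ε`-fraction.

All zero input is the tree's proved Riemann–von Mangoldt formula (`riemann_von_mangoldt_holds`)
and `γ₀ > 14` (through `RudnickSarnakZeros.lean`).

## References

* H. L. Montgomery, *The pair correlation of zeros of the zeta function*, Proc. Sympos. Pure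
  Math. 24 (1973), 181–193, §1.
* E. C. Titchmarsh, *The Theory of the Riemann Zeta-Function*, 2nd ed. (1986), Thm. 9.4, §14.34.
* Z. Rudnick, P. Sarnak, Duke Math. J. 81 (1996), 269–322, §1 Remark 1.
-/

noncomputable section

open Finset Filter Topology Real

namespace Literature.NumberTheory.LFunctions

namespace PairCount

/-! ## `x log x` -/

/-- For `0 < x ≤ y`: `y log y − x log x ≤ (y − x)(log y + 1)` (from `log t ≤ t − 1`). [folklore] -/
theorem mul_log_sub_mul_log_le {x y : ℝ} (hx : 0 < x) (hxy : x ≤ y) :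
    y * Real.log y - x * Real.log x ≤ (y - x) * (Real.log y + 1) := by
  have hy : 0 < y := hx.trans_le hxy
  have h1 : x * (Real.log y - Real.log x) ≤ y - x := by
    rw [← Real.log_div hy.ne' hx.ne']
    calc x * Real.log (y / x) ≤ x * (y / x - 1) :=
          mul_le_mul_of_nonneg_left (Real.log_le_sub_one_of_pos (by positivity)) hx.le
      _ = y - x := by field_simp
  nlinarith

/-- For `0 < x ≤ y`: `(y − x)(log x + 1) ≤ y log y − x log x` (from `1 − 1/t ≤ log t`). [folklore] -/
theorem le_mul_log_sub_mul_log {x y : ℝ} (hx : 0 < x) (hxy : x ≤ y) :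
    (y - x) * (Real.log x + 1) ≤ y * Real.log y - x * Real.log x := by
  have hy : 0 < y := hx.trans_le hxy
  have h1 : y - x ≤ y * (Real.log y - Real.log x) := by
    rw [← Real.log_div hy.ne' hx.ne']
    calc y - x = y * (1 - (y / x)⁻¹) := by field_simp
      _ ≤ y * Real.log (y / x) :=
          mul_le_mul_of_nonneg_left (Real.one_sub_inv_le_log_of_pos (by positivity)) hy.le
  nlinarith

/-- The two normalisations of a difference of ordinates, pointwise: for `0 < T/M < x, y ≤ T`,
`M ≥ 1`, `|(y log y − x log x) − (y − x) log T| ≤ |y − x| (log M + 1)`. [folklore] -/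
theorem abs_mul_log_sub_sub_mul_log_le {x y T M : ℝ} (hM : 1 ≤ M) (hT : 0 < T)
    (hx : T / M < x) (hxT : x ≤ T) (hy : T / M < y) (hyT : y ≤ T) :
    |(y * Real.log y - x * Real.log x) - (y - x) * Real.log T| ≤
      |y - x| * (Real.log M + 1) := by
  have hTM : 0 < T / M := by positivity
  have hlogM : 0 ≤ Real.log M := Real.log_nonneg hM
  -- `log t ∈ (log T - log M, log T]` for `t ∈ (T/M, T]`
  have hlog : ∀ t : ℝ, T / M < t → t ≤ T →
      Real.log T - Real.log M < Real.log t ∧ Real.log t ≤ Real.log T := by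
    intro t ht htT
    have ht0 : 0 < t := hTM.trans ht
    refine ⟨?_, Real.log_le_log ht0 htT⟩
    have := Real.log_lt_log hTM ht
    rwa [Real.log_div hT.ne' (by positivity)] at this
  rcases le_total x y with hxy | hxy
  · have hx0 : 0 < x := hTM.trans hx
    have h1 := mul_log_sub_mul_log_le hx0 hxy
    have h2 := le_mul_log_sub_mul_log hx0 hxy
    obtain ⟨hlx1, hlx2⟩ := hlog x hx hxT
    obtain ⟨hly1, hly2⟩ := hlog y hy hyT
    rw [abs_of_nonneg (sub_nonneg.2 hxy), abs_le]
    constructor <;> nlinarith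
  · have hy0 : 0 < y := hTM.trans hy
    have h1 := mul_log_sub_mul_log_le hy0 hxy
    have h2 := le_mul_log_sub_mul_log hy0 hxy
    obtain ⟨hlx1, hlx2⟩ := hlog x hx hxT
    obtain ⟨hly1, hly2⟩ := hlog y hy hyT
    rw [abs_of_nonpos (sub_nonpos.2 hxy), abs_le]
    constructor <;> nlinarith

/-- For `0 < x, y ≤ T` with `log x, log y ≥ -1`:
`|y log y − x log x| ≤ |y − x| (log T + 1)`. [folklore] -/
theorem abs_mul_log_sub_mul_log_le {x y T : ℝ} (hx : 0 < x) (hxT : x ≤ T) (hy : 0 < y)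
    (hyT : y ≤ T) (hlx : -1 ≤ Real.log x) (hly : -1 ≤ Real.log y) :
    |y * Real.log y - x * Real.log x| ≤ |y - x| * (Real.log T + 1) := by
  have hlxT := Real.log_le_log hx hxT
  have hlyT := Real.log_le_log hy hyT
  rcases le_total x y with hxy | hxy
  · have h1 := mul_log_sub_mul_log_le hx hxy
    have h2 := le_mul_log_sub_mul_log hx hxy
    rw [abs_of_nonneg (sub_nonneg.2 hxy), abs_le]
    constructor <;> nlinarith
  · have h1 := mul_log_sub_mul_log_le hy hxy
    have h2 := le_mul_log_sub_mul_log hy hxy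
    rw [abs_of_nonpos (sub_nonpos.2 hxy), abs_le]
    constructor <;> nlinarith

/-- For `0 < x, y`: `|y − x| (log (min x y) + 1) ≤ |y log y − x log x|`. [folklore] -/
theorem abs_sub_mul_log_min_le {x y : ℝ} (hx : 0 < x) (hy : 0 < y) :
    |y - x| * (Real.log (min x y) + 1) ≤ |y * Real.log y - x * Real.log x| := by
  rcases le_total x y with hxy | hxy
  · rw [min_eq_left hxy]
    have h2 := le_mul_log_sub_mul_log hx hxy
    rw [abs_of_nonneg (sub_nonneg.2 hxy)]
    exact h2.trans (le_abs_self _)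
  · rw [min_eq_right hxy]
    have h2 := le_mul_log_sub_mul_log hy hxy
    rw [abs_of_nonpos (sub_nonpos.2 hxy), abs_sub_comm]
    refine le_trans (le_of_eq (by ring)) (h2.trans (le_abs_self _))

end PairCount

/-! ## Ordinates: the two normalisations -/

/-- `γ̃_a − γ̃_b = (γ_a log γ_a − γ_b log γ_b) / 2π`. [folklore] -/
theorem normalizedOrdinate_sub (a b : ℕ) :
    normalizedOrdinate a - normalizedOrdinate b =
      (zetaOrdinate a * Real.log (zetaOrdinate a) -
        zetaOrdinate b * Real.log (zetaOrdinate b)) / (2 * π) := by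
  simp only [normalizedOrdinate]
  ring

/-- `-1 ≤ log γ_n` (indeed `log γ_n ≥ 2`). [folklore] -/
theorem neg_one_le_log_zetaOrdinate (n : ℕ) : -1 ≤ Real.log (zetaOrdinate n) := by
  linarith [RudnickSarnak.two_le_log_zetaOrdinate n]

/-- **Closeness of the two normalisations.** For indices `a, b` with `T/M < γ_a, γ_b ≤ T`
(`M ≥ 1`): `|(γ̃_a − γ̃_b) − (γ_a − γ_b) log T / 2π| ≤ |γ_a − γ_b| (log M + 1) / 2π`.
(Montgomery 1973 normalises by `log T / 2π`, Rudnick–Sarnak 1996 by `γ̃ = γ log γ / 2π`; for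
ordinates of size `≍ T` the two agree to first order.) [folklore] -/
theorem abs_normalizedDiff_sub_logDiff_le {a b : ℕ} {T M : ℝ} (hM : 1 ≤ M) (hT : 0 < T)
    (ha : T / M < zetaOrdinate a) (haT : zetaOrdinate a ≤ T) (hb : T / M < zetaOrdinate b)
    (hbT : zetaOrdinate b ≤ T) :
    |(normalizedOrdinate a - normalizedOrdinate b) -
        (zetaOrdinate a - zetaOrdinate b) * Real.log T / (2 * π)| ≤
      |zetaOrdinate a - zetaOrdinate b| * (Real.log M + 1) / (2 * π) := by
  have h := PairCount.abs_mul_log_sub_sub_mul_log_le hM hT hb hbT ha haT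
  rw [normalizedOrdinate_sub, ← sub_div, abs_div, abs_of_pos (by positivity : (0 : ℝ) < 2 * π)]
  exact div_le_div_of_nonneg_right h (by positivity)

/-- `|γ̃_a − γ̃_b| ≤ |γ_a − γ_b| (log T + 1) / 2π` for `γ_a, γ_b ≤ T`. [folklore] -/
theorem abs_normalizedDiff_le {a b : ℕ} {T : ℝ} (haT : zetaOrdinate a ≤ T)
    (hbT : zetaOrdinate b ≤ T) :
    |normalizedOrdinate a - normalizedOrdinate b| ≤
      |zetaOrdinate a - zetaOrdinate b| * (Real.log T + 1) / (2 * π) := by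
  have h := PairCount.abs_mul_log_sub_mul_log_le (zetaOrdinate_pos_holds b) hbT
    (zetaOrdinate_pos_holds a) haT (neg_one_le_log_zetaOrdinate b) (neg_one_le_log_zetaOrdinate a)
  rw [normalizedOrdinate_sub, abs_div, abs_of_pos (by positivity : (0 : ℝ) < 2 * π)]
  exact div_le_div_of_nonneg_right h (by positivity)

/-- `|γ_a − γ_b| (log min(γ_a, γ_b) + 1) / 2π ≤ |γ̃_a − γ̃_b|`. [folklore] -/
theorem abs_sub_mul_log_min_le_abs_normalizedDiff (a b : ℕ) :
    |zetaOrdinate a - zetaOrdinate b| *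
        (Real.log (min (zetaOrdinate a) (zetaOrdinate b)) + 1) / (2 * π) ≤
      |normalizedOrdinate a - normalizedOrdinate b| := by
  have h := PairCount.abs_sub_mul_log_min_le (zetaOrdinate_pos_holds a) (zetaOrdinate_pos_holds b)
  rw [abs_sub_comm (zetaOrdinate b) (zetaOrdinate a),
    abs_sub_comm (zetaOrdinate b * Real.log (zetaOrdinate b))] at h
  rw [normalizedOrdinate_sub, abs_div, abs_of_pos (by positivity : (0 : ℝ) < 2 * π)]
  exact div_le_div_of_nonneg_right h (by positivity)

/-- `|γ_a − γ_b| ≤ π |γ̃_a − γ̃_b|` (the normalisation expands distances by `≥ 1/π`, as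
`log γ ≥ 2`; `RudnickSarnak.sub_div_pi_le_of_two_le_log`). [folklore] -/
theorem abs_sub_le_pi_mul_abs_normalizedDiff (a b : ℕ) :
    |zetaOrdinate a - zetaOrdinate b| ≤ π * |normalizedOrdinate a - normalizedOrdinate b| := by
  rcases le_total (zetaOrdinate b) (zetaOrdinate a) with h | h
  · have := RudnickSarnak.sub_div_pi_le_of_two_le_log (zetaOrdinate_pos_holds b) h
      (RudnickSarnak.two_le_log_zetaOrdinate b)
    rw [div_le_iff₀ Real.pi_pos] at this
    rw [abs_of_nonneg (sub_nonneg.2 h)]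
    refine this.trans ?_
    rw [mul_comm]
    refine mul_le_mul_of_nonneg_left ?_ Real.pi_pos.le
    simp only [normalizedOrdinate]
    exact le_abs_self _
  · have := RudnickSarnak.sub_div_pi_le_of_two_le_log (zetaOrdinate_pos_holds a) h
      (RudnickSarnak.two_le_log_zetaOrdinate a)
    rw [div_le_iff₀ Real.pi_pos] at this
    rw [abs_of_nonpos (sub_nonpos.2 h), neg_sub]
    refine this.trans ?_
    rw [mul_comm]
    refine mul_le_mul_of_nonneg_left ?_ Real.pi_pos.le
    rw [abs_sub_comm]
    simp only [normalizedOrdinate]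
    exact le_abs_self _

/-! ## Counting: consequences of the Riemann–von Mangoldt formula -/

/-- `a < N(T) ↔ γ_a ≤ T`. [cite: Titchmarsh1986, §9.1] -/
theorem lt_zetaZeroCount_iff {a : ℕ} {T : ℝ} : a < zetaZeroCount T ↔ zetaOrdinate a ≤ T := by
  rw [riemann_von_mangoldt_holds.zetaOrdinate_le_iff]
  exact Nat.lt_iff_add_one_le

/-- `N(T) ≥ T log T / 4π` for large `T` (from `N(T) = (T/2π) log(T/2π) − T/2π + O(log T)`). [cite: Titchmarsh1986, Thm. 9.4] -/
theorem eventually_mul_le_zetaZeroCount :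
    ∀ᶠ T : ℝ in atTop, 1 / (4 * π) * (T * Real.log T) ≤ zetaZeroCount T := by
  obtain ⟨C₀, hC₀, hbd⟩ := riemann_von_mangoldt_holds.exists_pos
  have hlog2pi : Real.log (2 * π) ≤ 2 * π - 1 := Real.log_le_sub_one_of_pos (by positivity)
  filter_upwards [hbd.bound, eventually_ge_atTop (1 : ℝ), eventually_ge_atTop (16 * π * C₀),
    Real.tendsto_log_atTop.eventually_ge_atTop (16 * π)] with T hb h1 h2 h3
  rw [Real.norm_of_nonneg (Real.log_nonneg h1), Real.norm_eq_abs] at hb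
  have hb' := (abs_le.1 hb).1
  have hT : 0 < T := by linarith
  rw [Real.log_div hT.ne' (by positivity)] at hb'
  have hlogT : 0 ≤ Real.log T := Real.log_nonneg h1
  -- `(T/2π)(log 2π + 1) ≤ T` and `C₀ log T ≤ T log T / 16π`
  have e1 : T / (2 * π) * (Real.log (2 * π) + 1) ≤ T := by
    rw [div_mul_eq_mul_div, div_le_iff₀ (by positivity)]
    nlinarith
  have e2 : C₀ * Real.log T ≤ 1 / (16 * π) * (T * Real.log T) := by
    rw [div_mul_eq_mul_div, le_div_iff₀ (by positivity), one_mul]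
    nlinarith
  have e3 : T ≤ 1 / (16 * π) * (T * Real.log T) := by
    rw [div_mul_eq_mul_div, le_div_iff₀ (by positivity), one_mul]
    nlinarith
  have e4 : T / (2 * π) * (Real.log T - Real.log (2 * π)) - T / (2 * π) =
      8 * (1 / (16 * π) * (T * Real.log T)) - T / (2 * π) * (Real.log (2 * π) + 1) := by ring
  have e5 : 1 / (4 * π) * (T * Real.log T) = 4 * (1 / (16 * π) * (T * Real.log T)) := by ring
  rw [e5]
  rw [e4] at hb'
  set X := 1 / (16 * π) * (T * Real.log T) with hX
  have hX0 : 0 ≤ X := by positivity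
  linarith

/-- `0 < N(T)` in `ℝ` for large `T`. [cite: Titchmarsh1986, Thm. 9.4] -/
theorem eventually_natCast_zetaZeroCount_pos : ∀ᶠ T : ℝ in atTop, (0 : ℝ) < zetaZeroCount T := by
  filter_upwards [riemann_von_mangoldt_holds.eventually_self_le, eventually_gt_atTop (0 : ℝ)]
    with T h1 h2 using h2.trans_le h1

/-- `2 ≤ log T` for `T ≥ 8` (`log 8 = 3 log 2 > 2.07`). [folklore] -/
theorem two_le_log_of_eight_le {T : ℝ} (hT : 8 ≤ T) : 2 ≤ Real.log T := by
  have h8 : Real.log 8 = 3 * Real.log 2 := by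
    rw [show (8 : ℝ) = 2 ^ 3 by norm_num, Real.log_pow]
    norm_num
  have h2 := Real.log_two_gt_d9
  have : Real.log 8 ≤ Real.log T := Real.log_le_log (by norm_num) hT
  linarith

/-! ## Pairs with a small ordinate are negligible -/

/-- If `|δ_T| = |γ_a − γ_b| log T / 2π ≤ B` with `γ_a, γ_b ≤ T`, `log T ≥ 2`, then
`|δ_G| = |γ̃_a − γ̃_b| ≤ 3B/2` (`|δ_G| ≤ |δ_T| (1 + 1/log T)`). [folklore] -/
theorem abs_normalizedDiff_le_of_abs_logDiff_le {a b : ℕ} {T B : ℝ} (hlogT : 2 ≤ Real.log T)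
    (haT : zetaOrdinate a ≤ T) (hbT : zetaOrdinate b ≤ T)
    (h : |(zetaOrdinate a - zetaOrdinate b) * Real.log T / (2 * π)| ≤ B) :
    |normalizedOrdinate a - normalizedOrdinate b| ≤ 3 / 2 * B := by
  have h1 := abs_normalizedDiff_le haT hbT
  have hlogT0 : 0 < Real.log T := by linarith
  have h2pi : (0 : ℝ) < 2 * π := by positivity
  rw [abs_div, abs_mul, abs_of_pos hlogT0, abs_of_pos h2pi, div_le_iff₀ h2pi] at h
  refine h1.trans ?_
  rw [div_le_iff₀ h2pi]
  have h2 : |zetaOrdinate a - zetaOrdinate b| ≤ B * (2 * π) / Real.log T := by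
    rw [le_div_iff₀ hlogT0]; exact h
  have hB0 : 0 ≤ B * (2 * π) := le_trans (by positivity) h
  calc |zetaOrdinate a - zetaOrdinate b| * (Real.log T + 1)
      ≤ B * (2 * π) / Real.log T * (Real.log T + 1) :=
        mul_le_mul_of_nonneg_right h2 (by linarith)
    _ = B * (2 * π) * (1 + 1 / Real.log T) := by field_simp
    _ ≤ B * (2 * π) * (1 + 1 / 2) := by gcongr
    _ = 3 / 2 * B * (2 * π) := by ring

/-- **Dyadic blocks.** An off-diagonal pair `a ≠ b` with `γ_a ≤ T`, `|δ_G| ≤ 3B/2` and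
`T_* < min(γ_a, γ_b) ≤ T/2^{m₀}` (`T_* ≥ 8`, `T_* ≥ 3πB/2`) lies, for the `n` with
`2ⁿ ≤ T / min γ < 2ⁿ⁺¹`, below `N(T')`, `T' = 2T/2ⁿ`, with `|δ_{T'}| ≤ 2B`; moreover
`m₀ ≤ n` and `2ⁿ T_* < T`. [folklore] -/
theorem exists_dyadic_block {a b : ℕ} {T Tstar B : ℝ} {m₀ : ℕ} (hB : 0 < B) (hTs8 : 8 ≤ Tstar)
    (hTsD : 3 * π / 2 * B ≤ Tstar) (haT : zetaOrdinate a ≤ T)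
    (hG : |normalizedOrdinate a - normalizedOrdinate b| ≤ 3 / 2 * B)
    (hsmall : Tstar < min (zetaOrdinate a) (zetaOrdinate b))
    (hmin : min (zetaOrdinate a) (zetaOrdinate b) ≤ T / 2 ^ m₀) :
    ∃ n : ℕ, m₀ ≤ n ∧ (2 : ℝ) ^ n * Tstar < T ∧
      zetaOrdinate a ≤ 2 * T / 2 ^ n ∧ zetaOrdinate b ≤ 2 * T / 2 ^ n ∧
      |(zetaOrdinate a - zetaOrdinate b) * Real.log (2 * T / 2 ^ n) / (2 * π)| ≤ 2 * B := by
  obtain ⟨γm, hγm⟩ : ∃ γm : ℝ, γm = min (zetaOrdinate a) (zetaOrdinate b) := ⟨_, rfl⟩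
  rw [← hγm] at hsmall hmin
  have hγm_pos : 0 < γm := by linarith
  have hγmT : γm ≤ T := by rw [hγm]; exact (min_le_left _ _).trans haT
  have hT0 : 0 < T := by linarith
  -- `|γ_a - γ_b| ≤ 3πB/2`, so both ordinates are `≤ γm + 3πB/2`
  have hD : |zetaOrdinate a - zetaOrdinate b| ≤ 3 * π / 2 * B := by
    refine (abs_sub_le_pi_mul_abs_normalizedDiff a b).trans ?_
    nlinarith [Real.pi_pos]
  have hab' := abs_le.1 hD
  have ha_le : zetaOrdinate a ≤ γm + 3 * π / 2 * B := by
    rw [hγm]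
    rcases le_total (zetaOrdinate a) (zetaOrdinate b) with h | h
    · rw [min_eq_left h]; linarith
    · rw [min_eq_right h]; linarith
  have hb_le : zetaOrdinate b ≤ γm + 3 * π / 2 * B := by
    rw [hγm]
    rcases le_total (zetaOrdinate a) (zetaOrdinate b) with h | h
    · rw [min_eq_left h]; linarith
    · rw [min_eq_right h]; linarith
  -- the dyadic scale
  have hx1 : 1 ≤ T / γm := by rw [le_div_iff₀ hγm_pos]; linarith
  obtain ⟨n, hn1, hn2⟩ := exists_nat_pow_near hx1 (by norm_num : (1 : ℝ) < 2)
  have h2n : (0 : ℝ) < 2 ^ n := by positivity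
  rw [le_div_iff₀ hγm_pos] at hn1
  rw [div_lt_iff₀ hγm_pos, pow_succ] at hn2
  obtain ⟨T', hT'⟩ : ∃ T' : ℝ, T' = 2 * T / 2 ^ n := ⟨_, rfl⟩
  have hT'1 : 2 * γm ≤ T' := by rw [hT', le_div_iff₀ h2n]; nlinarith
  have hT'2 : T' < 4 * γm := by rw [hT', div_lt_iff₀ h2n]; nlinarith
  have hT'pos : 0 < T' := by linarith
  have hlogT' : 2 ≤ Real.log T' := two_le_log_of_eight_le (by linarith)
  refine ⟨n, ?_, ?_, ?_, ?_, ?_⟩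
  · -- `m₀ ≤ n`
    have hm : (2 : ℝ) ^ m₀ * γm ≤ T := by
      rw [le_div_iff₀ (by positivity : (0 : ℝ) < 2 ^ m₀)] at hmin; linarith
    have : (2 : ℝ) ^ m₀ < 2 ^ (n + 1) := by
      rw [pow_succ]
      by_contra hle
      push Not at hle
      nlinarith
    have := (pow_lt_pow_iff_right₀ (by norm_num : (1 : ℝ) < 2)).1 this
    omega
  · nlinarith
  · rw [← hT']; linarith
  · rw [← hT']; linarith
  · -- `|δ_{T'}| ≤ 2B`
    rw [← hT']
    have hlow := abs_sub_mul_log_min_le_abs_normalizedDiff a b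
    rw [← hγm] at hlow
    have hlogγm : Real.log T' - 2 * Real.log 2 < Real.log γm := by
      have : Real.log (T' / 4) < Real.log γm :=
        Real.log_lt_log (by positivity) (by linarith)
      rw [Real.log_div hT'pos.ne' (by norm_num), show (4 : ℝ) = 2 ^ 2 by norm_num,
        Real.log_pow] at this
      push_cast at this
      linarith
    have hl2 := Real.log_two_lt_d9
    have hden : 0 < Real.log γm + 1 := by linarith
    have h2pi : (0 : ℝ) < 2 * π := by positivity
    rw [abs_div, abs_mul, abs_of_pos (by linarith : (0 : ℝ) < Real.log T'), abs_of_pos h2pi,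
      div_le_iff₀ h2pi]
    rw [div_le_iff₀ h2pi] at hlow
    -- `|γ_a - γ_b| (log γm + 1) ≤ 2π · (3B/2)` and `log T' ≤ (4/3)(log γm + 1)`
    have h1 : |zetaOrdinate a - zetaOrdinate b| * (Real.log γm + 1) ≤ 3 / 2 * B * (2 * π) := by
      nlinarith
    have h3 : Real.log T' ≤ 4 / 3 * (Real.log γm + 1) := by nlinarith
    have h4 : 0 ≤ |zetaOrdinate a - zetaOrdinate b| := abs_nonneg _
    calc |zetaOrdinate a - zetaOrdinate b| * Real.log T'
        ≤ |zetaOrdinate a - zetaOrdinate b| * (4 / 3 * (Real.log γm + 1)) :=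
          mul_le_mul_of_nonneg_left h3 h4
      _ = 4 / 3 * (|zetaOrdinate a - zetaOrdinate b| * (Real.log γm + 1)) := by ring
      _ ≤ 4 / 3 * (3 / 2 * B * (2 * π)) := by gcongr
      _ = 2 * B * (2 * π) := by ring

/-- **Core estimate.** With `T_* ≥ max(8, 3πB/2, T₀, x₀)`, an a-priori bound
`#W(T') ≤ C' N(T')` for `T' ≥ T₀` on the pairs below `N(T')` with `|δ_{T'}|, |δ_G| ≤ 2B`, and
`N(x) ≤ C₁ x log x` for `x ≥ x₀`: for every `m₀` and `T ≥ T_*`, the off-diagonal pairs below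
`N(T)` with `min γ ≤ T/2^{m₀}` and `|δ_T| ≤ B ∨ |δ_G| ≤ B` number at most
`N(T_* + 3πB/2)² + 4 C' C₁ T log(2T) / 2^{m₀}`. [folklore] -/
theorem card_smallPairs_le_core {B C' C₁ T₀ x₀ Tstar : ℝ} (hB : 0 < B) (hC' : 0 ≤ C')
    (hTs8 : 8 ≤ Tstar) (hTsD : 3 * π / 2 * B ≤ Tstar) (hTsT₀ : T₀ ≤ Tstar)
    (hTsx₀ : x₀ ≤ Tstar)
    (hWcard : ∀ T' : ℝ, T₀ ≤ T' →
      ((((Finset.range (zetaZeroCount T')).offDiag).filter fun p : ℕ × ℕ ↦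
        |(zetaOrdinate p.1 - zetaOrdinate p.2) * Real.log T' / (2 * π)| ≤ 2 * B ∧
        |normalizedOrdinate p.1 - normalizedOrdinate p.2| ≤ 2 * B).card : ℝ) ≤
          C' * zetaZeroCount T')
    (hx₀ : ∀ x : ℝ, x₀ ≤ x → (zetaZeroCount x : ℝ) ≤ C₁ * (x * Real.log x))
    (m₀ : ℕ) {T : ℝ} (hT : Tstar ≤ T) :
    ((((Finset.range (zetaZeroCount T)).offDiag).filter fun p : ℕ × ℕ ↦
        min (zetaOrdinate p.1) (zetaOrdinate p.2) ≤ T / 2 ^ m₀ ∧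
        (|(zetaOrdinate p.1 - zetaOrdinate p.2) * Real.log T / (2 * π)| ≤ B ∨
         |normalizedOrdinate p.1 - normalizedOrdinate p.2| ≤ B)).card : ℝ) ≤
      (zetaZeroCount (Tstar + 3 * π / 2 * B) : ℝ) ^ 2 +
        4 * C' * C₁ * (T * Real.log (2 * T)) * (1 / 2) ^ m₀ := by
  classical
  have hTs0 : 0 < Tstar := by linarith
  have hT0 : 0 < T := hTs0.trans_le hT
  have hlogT : 2 ≤ Real.log T := two_le_log_of_eight_le (hTs8.trans hT)
  have hC₁ : 0 ≤ C₁ := by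
    have h := hx₀ Tstar hTsx₀
    have h0 : (0 : ℝ) ≤ zetaZeroCount Tstar := Nat.cast_nonneg _
    have hpos : 0 < Tstar * Real.log Tstar := by
      have := two_le_log_of_eight_le hTs8; positivity
    nlinarith
  -- the sets
  obtain ⟨W, hW⟩ : ∃ W : ℝ → Finset (ℕ × ℕ), W = fun T' ↦
    ((Finset.range (zetaZeroCount T')).offDiag).filter fun p : ℕ × ℕ ↦
      |(zetaOrdinate p.1 - zetaOrdinate p.2) * Real.log T' / (2 * π)| ≤ 2 * B ∧
      |normalizedOrdinate p.1 - normalizedOrdinate p.2| ≤ 2 * B := ⟨_, rfl⟩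
  have hmemW : ∀ T' (p : ℕ × ℕ), p ∈ W T' ↔ (zetaOrdinate p.1 ≤ T' ∧ zetaOrdinate p.2 ≤ T' ∧
      p.1 ≠ p.2) ∧ |(zetaOrdinate p.1 - zetaOrdinate p.2) * Real.log T' / (2 * π)| ≤ 2 * B ∧
      |normalizedOrdinate p.1 - normalizedOrdinate p.2| ≤ 2 * B := by
    intro T' p
    rw [hW, Finset.mem_filter, Finset.mem_offDiag, Finset.mem_range, Finset.mem_range,
      lt_zetaZeroCount_iff, lt_zetaZeroCount_iff]
  have hWcard' : ∀ T', T₀ ≤ T' → ((W T').card : ℝ) ≤ C' * zetaZeroCount T' := by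
    intro T' hT'; rw [hW]; exact hWcard T' hT'
  obtain ⟨SM, hSM⟩ : ∃ SM : Finset (ℕ × ℕ), SM =
    ((Finset.range (zetaZeroCount T)).offDiag).filter fun p : ℕ × ℕ ↦
      min (zetaOrdinate p.1) (zetaOrdinate p.2) ≤ T / 2 ^ m₀ ∧
      (|(zetaOrdinate p.1 - zetaOrdinate p.2) * Real.log T / (2 * π)| ≤ B ∨
       |normalizedOrdinate p.1 - normalizedOrdinate p.2| ≤ B) := ⟨_, rfl⟩
  rw [← hSM]
  obtain ⟨A, hA⟩ : ∃ A : Finset (ℕ × ℕ), A =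
    (Finset.range (zetaZeroCount (Tstar + 3 * π / 2 * B))).offDiag := ⟨_, rfl⟩
  obtain ⟨Nmax, hNmax⟩ := pow_unbounded_of_one_lt (T / Tstar) (by norm_num : (1 : ℝ) < 2)
  obtain ⟨I, hI⟩ : ∃ I : Finset ℕ, I =
    (Finset.range Nmax).filter fun n ↦ m₀ ≤ n ∧ (2 : ℝ) ^ n * Tstar < T := ⟨_, rfl⟩
  -- every small pair is tiny or in a dyadic block
  have hincl : SM ⊆ A ∪ I.biUnion fun n ↦ W (2 * T / 2 ^ n) := by
    intro p hp
    rw [hSM, Finset.mem_filter, Finset.mem_offDiag, Finset.mem_range, Finset.mem_range,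
      lt_zetaZeroCount_iff, lt_zetaZeroCount_iff] at hp
    obtain ⟨⟨haT, hbT, hab⟩, hmin, hstat⟩ := hp
    have hG : |normalizedOrdinate p.1 - normalizedOrdinate p.2| ≤ 3 / 2 * B := by
      rcases hstat with h | h
      · exact abs_normalizedDiff_le_of_abs_logDiff_le hlogT haT hbT h
      · linarith
    rw [Finset.mem_union]
    by_cases hsm : min (zetaOrdinate p.1) (zetaOrdinate p.2) ≤ Tstar
    · -- tiny ordinates
      left
      have hD : |zetaOrdinate p.1 - zetaOrdinate p.2| ≤ 3 * π / 2 * B := by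
        refine (abs_sub_le_pi_mul_abs_normalizedDiff p.1 p.2).trans ?_
        nlinarith [Real.pi_pos]
      have hab' := abs_le.1 hD
      rw [hA, Finset.mem_offDiag, Finset.mem_range, Finset.mem_range, lt_zetaZeroCount_iff,
        lt_zetaZeroCount_iff]
      rcases le_total (zetaOrdinate p.1) (zetaOrdinate p.2) with h | h
      · rw [min_eq_left h] at hsm
        exact ⟨by linarith, by linarith, hab⟩
      · rw [min_eq_right h] at hsm
        exact ⟨by linarith, by linarith, hab⟩
    · -- a dyadic block
      right
      push Not at hsm
      obtain ⟨n, hn1, hn2, haT', hbT', hδ⟩ :=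
        exists_dyadic_block hB hTs8 hTsD haT hG hsm hmin
      rw [Finset.mem_biUnion]
      refine ⟨n, ?_, ?_⟩
      · rw [hI, Finset.mem_filter, Finset.mem_range]
        refine ⟨?_, hn1, hn2⟩
        have h1 : (2 : ℝ) ^ n < T / Tstar := by rw [lt_div_iff₀ hTs0]; exact hn2
        have h2 : (2 : ℝ) ^ n < 2 ^ Nmax := h1.trans hNmax
        exact (pow_lt_pow_iff_right₀ (by norm_num : (1 : ℝ) < 2)).1 h2
      · rw [hmemW]
        exact ⟨⟨haT', hbT', hab⟩, hδ, by linarith⟩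
  -- counting
  have hAcard : (A.card : ℝ) ≤ (zetaZeroCount (Tstar + 3 * π / 2 * B) : ℝ) ^ 2 := by
    have hsub : A ⊆ Finset.range (zetaZeroCount (Tstar + 3 * π / 2 * B)) ×ˢ
        Finset.range (zetaZeroCount (Tstar + 3 * π / 2 * B)) := by
      intro p hp
      rw [hA, Finset.mem_offDiag] at hp
      exact Finset.mem_product.2 ⟨hp.1, hp.2.1⟩
    have h := Finset.card_le_card hsub
    rw [Finset.card_product, Finset.card_range] at h
    rw [sq]
    exact_mod_cast h
  have hWn : ∀ n ∈ I, ((W (2 * T / 2 ^ n)).card : ℝ) ≤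
      C' * C₁ * (2 * T * Real.log (2 * T)) * (1 / 2) ^ n := by
    intro n hn
    rw [hI, Finset.mem_filter] at hn
    obtain ⟨-, -, hn⟩ := hn
    have h2n : (0 : ℝ) < 2 ^ n := by positivity
    obtain ⟨T', hT'⟩ : ∃ T' : ℝ, T' = 2 * T / 2 ^ n := ⟨_, rfl⟩
    rw [← hT']
    have hT'Ts : 2 * Tstar < T' := by rw [hT', lt_div_iff₀ h2n]; linarith
    have hT'pos : 0 < T' := by linarith
    have hT'le : T' ≤ 2 * T := by
      rw [hT', div_le_iff₀ h2n]
      have : (1 : ℝ) ≤ 2 ^ n := one_le_pow₀ (by norm_num)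
      nlinarith
    have h1 := hWcard' T' (by linarith)
    have h2 : (zetaZeroCount T' : ℝ) ≤ C₁ * (T' * Real.log T') := hx₀ T' (by linarith)
    have h3 : Real.log T' ≤ Real.log (2 * T) := Real.log_le_log hT'pos hT'le
    have h4 : 0 ≤ Real.log T' := by
      linarith [two_le_log_of_eight_le (by linarith : (8 : ℝ) ≤ T')]
    have h5 : T' * (1 / 2) ^ n * 2 ^ n = T' := by
      rw [mul_assoc, ← mul_pow]; norm_num
    have h6 : T' = 2 * T * (1 / 2) ^ n := by
      rw [hT', div_eq_mul_inv, ← inv_pow, one_div]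
    calc ((W T').card : ℝ) ≤ C' * zetaZeroCount T' := h1
      _ ≤ C' * (C₁ * (T' * Real.log T')) := mul_le_mul_of_nonneg_left h2 hC'
      _ ≤ C' * (C₁ * (T' * Real.log (2 * T))) := by gcongr
      _ = C' * C₁ * (2 * T * Real.log (2 * T)) * (1 / 2) ^ n := by rw [h6]; ring
  have hgeom : ∑ n ∈ I, ((1 : ℝ) / 2) ^ n ≤ 2 * (1 / 2) ^ m₀ := by
    have hsub : I ⊆ Finset.Ico m₀ Nmax := by
      intro n hn
      rw [hI, Finset.mem_filter, Finset.mem_range] at hn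
      exact Finset.mem_Ico.2 ⟨hn.2.1, hn.1⟩
    calc ∑ n ∈ I, ((1 : ℝ) / 2) ^ n ≤ ∑ n ∈ Finset.Ico m₀ Nmax, ((1 : ℝ) / 2) ^ n :=
          Finset.sum_le_sum_of_subset_of_nonneg hsub fun n _ _ ↦ by positivity
      _ ≤ ((1 : ℝ) / 2) ^ m₀ / (1 - 1 / 2) :=
          geom_sum_Ico_le_of_lt_one (by norm_num) (by norm_num)
      _ = 2 * (1 / 2) ^ m₀ := by ring
  have hTlog : 0 ≤ 2 * T * Real.log (2 * T) := by
    have : 0 ≤ Real.log (2 * T) := Real.log_nonneg (by linarith)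
    positivity
  calc (SM.card : ℝ) ≤ ((A ∪ I.biUnion fun n ↦ W (2 * T / 2 ^ n)).card : ℝ) := by
        exact_mod_cast Finset.card_le_card hincl
    _ ≤ (A.card : ℝ) + ((I.biUnion fun n ↦ W (2 * T / 2 ^ n)).card : ℝ) := by
        exact_mod_cast Finset.card_union_le _ _
    _ ≤ (zetaZeroCount (Tstar + 3 * π / 2 * B) : ℝ) ^ 2 +
          ∑ n ∈ I, ((W (2 * T / 2 ^ n)).card : ℝ) := by
        gcongr
        exact_mod_cast Finset.card_biUnion_le
    _ ≤ (zetaZeroCount (Tstar + 3 * π / 2 * B) : ℝ) ^ 2 +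
          ∑ n ∈ I, C' * C₁ * (2 * T * Real.log (2 * T)) * (1 / 2) ^ n := by
        gcongr with n hn
        exact hWn n hn
    _ = (zetaZeroCount (Tstar + 3 * π / 2 * B) : ℝ) ^ 2 +
          C' * C₁ * (2 * T * Real.log (2 * T)) * ∑ n ∈ I, ((1 : ℝ) / 2) ^ n := by
        rw [Finset.mul_sum]
    _ ≤ (zetaZeroCount (Tstar + 3 * π / 2 * B) : ℝ) ^ 2 +
          C' * C₁ * (2 * T * Real.log (2 * T)) * (2 * (1 / 2) ^ m₀) := by
        gcongr
    _ = _ := by ring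

/-- **Negligibility of the pairs with a small ordinate** (the hypothesis `hsmall` of
`PairCount.tendsto_card_filter_Icc_div_of_close` for the zeta ordinates, with
`sm M T p ↔ min(γ_a, γ_b) ≤ T/M`). Fix `B > 0` and assume the a-priori bound: for large `T'`, the
off-diagonal pairs `a ≠ b < N(T')` with `|δ_{T'}| ≤ 2B` and `|δ_G| ≤ 2B` number at most
`C N(T')`. Then for every `ε > 0` there is `M ≥ 1` such that, for large `T`, the pairs
`a ≠ b < N(T)` with `min(γ_a, γ_b) ≤ T/M` and `|δ_T| ≤ B ∨ |δ_G| ≤ B` number at most `ε N(T)`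
(`card_smallPairs_le_core` with `M = 2^{m₀}` large, against `N(T) ≥ T log T / 4π`). [folklore] -/
theorem eventually_card_smallPairs_le {B : ℝ} (hB : 0 < B)
    (hapr : ∃ C : ℝ, ∀ᶠ T : ℝ in atTop,
      ((((Finset.range (zetaZeroCount T)).offDiag).filter fun p : ℕ × ℕ ↦
        |(zetaOrdinate p.1 - zetaOrdinate p.2) * Real.log T / (2 * π)| ≤ 2 * B ∧
        |normalizedOrdinate p.1 - normalizedOrdinate p.2| ≤ 2 * B).card : ℝ) ≤
          C * zetaZeroCount T) {ε : ℝ} (hε : 0 < ε) :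
    ∃ M : ℝ, 1 ≤ M ∧ ∀ᶠ T : ℝ in atTop,
      ((((Finset.range (zetaZeroCount T)).offDiag).filter fun p : ℕ × ℕ ↦
        min (zetaOrdinate p.1) (zetaOrdinate p.2) ≤ T / M ∧
        (|(zetaOrdinate p.1 - zetaOrdinate p.2) * Real.log T / (2 * π)| ≤ B ∨
         |normalizedOrdinate p.1 - normalizedOrdinate p.2| ≤ B)).card : ℝ) ≤
          ε * zetaZeroCount T := by
  obtain ⟨C, hC⟩ := hapr
  obtain ⟨T₀, hT₀⟩ := eventually_atTop.1 hC
  obtain ⟨C₁, hC₁, hup⟩ := riemann_von_mangoldt_holds.eventually_le_mul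
  obtain ⟨x₀, hx₀⟩ := eventually_atTop.1 hup
  obtain ⟨C', hC'⟩ : ∃ C' : ℝ, C' = max C 0 := ⟨_, rfl⟩
  have hC'0 : 0 ≤ C' := by rw [hC']; exact le_max_right _ _
  obtain ⟨Tstar, hTstar⟩ : ∃ Tstar : ℝ, Tstar = max (max T₀ x₀) (max 8 (3 * π / 2 * B)) :=
    ⟨_, rfl⟩
  have hTs_T₀ : T₀ ≤ Tstar := by rw [hTstar]; exact le_trans (le_max_left _ _) (le_max_left _ _)
  have hTs_x₀ : x₀ ≤ Tstar := by rw [hTstar]; exact le_trans (le_max_right _ _) (le_max_left _ _)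
  have hTs_8 : 8 ≤ Tstar := by rw [hTstar]; exact le_trans (le_max_left _ _) (le_max_right _ _)
  have hTs_D : 3 * π / 2 * B ≤ Tstar := by
    rw [hTstar]; exact le_trans (le_max_right _ _) (le_max_right _ _)
  have hWcard : ∀ T' : ℝ, T₀ ≤ T' →
      ((((Finset.range (zetaZeroCount T')).offDiag).filter fun p : ℕ × ℕ ↦
        |(zetaOrdinate p.1 - zetaOrdinate p.2) * Real.log T' / (2 * π)| ≤ 2 * B ∧
        |normalizedOrdinate p.1 - normalizedOrdinate p.2| ≤ 2 * B).card : ℝ) ≤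
          C' * zetaZeroCount T' := by
    intro T' hT'
    refine (hT₀ T' hT').trans ?_
    rw [hC']
    exact mul_le_mul_of_nonneg_right (le_max_left _ _) (Nat.cast_nonneg _)
  obtain ⟨C₀, hC₀⟩ : ∃ C₀ : ℝ, C₀ = (zetaZeroCount (Tstar + 3 * π / 2 * B) : ℝ) ^ 2 := ⟨_, rfl⟩
  have core := fun (m₀ : ℕ) (T : ℝ) (hT : Tstar ≤ T) ↦
    card_smallPairs_le_core hB hC'0 hTs_8 hTs_D hTs_T₀ hTs_x₀ hWcard hx₀ m₀ hT
  -- choice of the scale `M = 2 ^ m₀`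
  have hgeo0 : Tendsto (fun m : ℕ ↦ ((1 : ℝ) / 2) ^ m) atTop (𝓝 0) :=
    tendsto_pow_atTop_nhds_zero_of_lt_one (by norm_num) (by norm_num)
  have hK : 0 < ε / (4 * π) / (16 * (C' * C₁ + 1)) := by positivity
  obtain ⟨m₀, hm₀⟩ := eventually_atTop.1 ((tendsto_order.1 hgeo0).2 _ hK)
  have hpow : ((1 : ℝ) / 2) ^ m₀ < ε / (4 * π) / (16 * (C' * C₁ + 1)) := hm₀ m₀ le_rfl
  refine ⟨2 ^ m₀, one_le_pow₀ (by norm_num), ?_⟩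
  have hC₀ev : ∀ᶠ T : ℝ in atTop, C₀ ≤ ε / 2 * zetaZeroCount T := by
    have h := (tendsto_natCast_atTop_atTop (R := ℝ)).comp
      riemann_von_mangoldt_holds.tendsto_zetaZeroCount_atTop
    filter_upwards [h.eventually_ge_atTop (C₀ / (ε / 2))] with T hT
    rw [div_le_iff₀ (by positivity)] at hT
    simpa [mul_comm] using hT
  filter_upwards [eventually_ge_atTop Tstar, eventually_ge_atTop (2 : ℝ), hC₀ev,
    eventually_mul_le_zetaZeroCount] with T hT h2 hC₀T hlow
  have hcore := core m₀ T hT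
  rw [← hC₀] at hcore
  have hT0 : 0 < T := by linarith
  have hlogT : 0 ≤ Real.log T := Real.log_nonneg (by linarith)
  have hlog2T : Real.log (2 * T) ≤ 2 * Real.log T := by
    rw [Real.log_mul (by norm_num) hT0.ne']
    have : Real.log 2 ≤ Real.log T := Real.log_le_log (by norm_num) h2
    linarith
  have hmain : 4 * C' * C₁ * (T * Real.log (2 * T)) * (1 / 2) ^ m₀ ≤
      ε / 2 * (1 / (4 * π) * (T * Real.log T)) := by
    have e1 : 4 * C' * C₁ * (T * Real.log (2 * T)) * (1 / 2) ^ m₀ ≤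
        4 * C' * C₁ * (T * (2 * Real.log T)) * (1 / 2) ^ m₀ := by gcongr
    refine e1.trans ?_
    have e2 : 4 * C' * C₁ * (T * (2 * Real.log T)) * (1 / 2) ^ m₀ ≤
        4 * C' * C₁ * (T * (2 * Real.log T)) * (ε / (4 * π) / (16 * (C' * C₁ + 1))) :=
      mul_le_mul_of_nonneg_left hpow.le (by positivity)
    refine e2.trans ?_
    rw [show 4 * C' * C₁ * (T * (2 * Real.log T)) * (ε / (4 * π) / (16 * (C' * C₁ + 1))) =
      ε / 2 * (1 / (4 * π) * (T * Real.log T)) * (C' * C₁ / (C' * C₁ + 1)) by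
        field_simp; ring]
    have hfrac : C' * C₁ / (C' * C₁ + 1) ≤ 1 := by
      rw [div_le_one (by positivity)]; linarith
    have hnn : 0 ≤ ε / 2 * (1 / (4 * π) * (T * Real.log T)) := by positivity
    exact mul_le_of_le_one_right hnn hfrac
  calc _ ≤ C₀ + 4 * C' * C₁ * (T * Real.log (2 * T)) * (1 / 2) ^ m₀ := hcore
    _ ≤ ε / 2 * zetaZeroCount T + ε / 2 * (1 / (4 * π) * (T * Real.log T)) :=
        add_le_add hC₀T hmain
    _ ≤ ε / 2 * zetaZeroCount T + ε / 2 * zetaZeroCount T := by gcongr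
    _ = ε * zetaZeroCount T := by ring

/-! ## Closeness of the two statistics off the small pairs -/

/-- **Closeness** (the hypothesis `hclose` of `PairCount.tendsto_card_filter_Icc_div_of_close`):
for `M ≥ 1`, `B > 0`, `ε > 0` and large `T`, every off-diagonal pair `a ≠ b < N(T)` with
`min(γ_a, γ_b) > T/M` and `|δ_T| ≤ B` or `|δ_G| ≤ B` has `|δ_T − δ_G| ≤ ε`
(`|δ_G − δ_T| ≤ |δ_T| (log M + 1)/log T`, `abs_normalizedDiff_sub_logDiff_le`). [folklore] -/
theorem eventually_close_logDiff_normalizedDiff {M : ℝ} (hM : 1 ≤ M) {B : ℝ} (hB : 0 < B)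
    {ε : ℝ} (hε : 0 < ε) :
    ∀ᶠ T : ℝ in atTop, ∀ p ∈ (Finset.range (zetaZeroCount T)).offDiag,
      ¬ (min (zetaOrdinate p.1) (zetaOrdinate p.2) ≤ T / M) →
      (|(zetaOrdinate p.1 - zetaOrdinate p.2) * Real.log T / (2 * π)| ≤ B ∨
        |normalizedOrdinate p.1 - normalizedOrdinate p.2| ≤ B) →
      |(zetaOrdinate p.1 - zetaOrdinate p.2) * Real.log T / (2 * π) -
        (normalizedOrdinate p.1 - normalizedOrdinate p.2)| ≤ ε := by
  have hlogM : 0 ≤ Real.log M := Real.log_nonneg hM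
  filter_upwards [eventually_gt_atTop (0 : ℝ),
    Real.tendsto_log_atTop.eventually_ge_atTop (max (2 * (Real.log M + 1))
      (2 * B * (Real.log M + 1) / ε))] with T hT0 hlogT
  have hL1 : 2 * (Real.log M + 1) ≤ Real.log T := le_trans (le_max_left _ _) hlogT
  have hL2 : 2 * B * (Real.log M + 1) / ε ≤ Real.log T := le_trans (le_max_right _ _) hlogT
  have hlogT0 : 0 < Real.log T := by linarith
  rw [div_le_iff₀ hε] at hL2
  intro p hp hsm hstat
  rw [Finset.mem_offDiag, Finset.mem_range, Finset.mem_range, lt_zetaZeroCount_iff,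
    lt_zetaZeroCount_iff] at hp
  obtain ⟨haT, hbT, -⟩ := hp
  rw [not_le, lt_min_iff] at hsm
  have hkey := abs_normalizedDiff_sub_logDiff_le hM hT0 hsm.1 haT hsm.2 hbT
  have h2pi : (0 : ℝ) < 2 * π := by positivity
  -- `|δ_G - δ_T| ≤ |δ_T| (log M + 1) / log T`
  set u : ℝ := zetaOrdinate p.1 - zetaOrdinate p.2 with hu
  have hδT : |u * Real.log T / (2 * π)| = |u| * Real.log T / (2 * π) := by
    rw [abs_div, abs_mul, abs_of_pos hlogT0, abs_of_pos h2pi]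
  have hu0 : 0 ≤ |u| := abs_nonneg u
  have hlM1 : 0 < Real.log M + 1 := by linarith
  -- it suffices to bound `|u| log T` by `2B · 2π`
  have hfinal : |u| * Real.log T ≤ 2 * B * (2 * π) →
      |(normalizedOrdinate p.1 - normalizedOrdinate p.2) - u * Real.log T / (2 * π)| ≤ ε := by
    intro hu2
    refine hkey.trans ?_
    rw [div_le_iff₀ h2pi]
    -- `|u| (log M + 1) log T ≤ 2B 2π (log M + 1) ≤ 2π (log T ε)`
    have h1 : |u| * (Real.log M + 1) * Real.log T ≤ ε * (2 * π) * Real.log T :=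
      calc |u| * (Real.log M + 1) * Real.log T = |u| * Real.log T * (Real.log M + 1) := by ring
        _ ≤ 2 * B * (2 * π) * (Real.log M + 1) := mul_le_mul_of_nonneg_right hu2 hlM1.le
        _ = 2 * π * (2 * B * (Real.log M + 1)) := by ring
        _ ≤ 2 * π * (Real.log T * ε) := mul_le_mul_of_nonneg_left hL2 h2pi.le
        _ = ε * (2 * π) * Real.log T := by ring
    exact le_of_mul_le_mul_right h1 hlogT0
  rw [abs_sub_comm]
  apply hfinal
  rcases hstat with h | h
  · -- `|δ_T| ≤ B`
    rw [hδT, div_le_iff₀ h2pi] at h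
    nlinarith
  · -- `|δ_G| ≤ B`: `|δ_T| ≤ |δ_G| + |δ_T - δ_G| ≤ B + |δ_T| / 2`
    have t1 := abs_sub_abs_le_abs_sub (u * Real.log T / (2 * π))
      (normalizedOrdinate p.1 - normalizedOrdinate p.2)
    have t2 : |u * Real.log T / (2 * π) - (normalizedOrdinate p.1 - normalizedOrdinate p.2)| =
        |(normalizedOrdinate p.1 - normalizedOrdinate p.2) - u * Real.log T / (2 * π)| :=
      abs_sub_comm _ _
    have htri : |u| * Real.log T / (2 * π) ≤ B + |u| * (Real.log M + 1) / (2 * π) := by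
      rw [← hδT]; linarith
    rw [div_le_iff₀ h2pi, add_mul, div_mul_cancel₀ _ h2pi.ne'] at htri
    -- `|u| (log M + 1) ≤ |u| log T / 2`
    have hhalf : |u| * (Real.log M + 1) ≤ |u| * Real.log T / 2 := by
      rw [le_div_iff₀ (by norm_num : (0 : ℝ) < 2)]
      nlinarith
    nlinarith

/-! ## Exchange of the two normalisations for box statistics -/

/-- **Montgomery boxes ⇒ Rudnick–Sarnak boxes.** If for all `α < β` the off-diagonal pairs
`a ≠ b < N(T)` with `(γ_a − γ_b) log T / 2π ∈ [α, β]`, divided by `N(T)`, tend to `∫_α^β w`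
(`0 ≤ w ≤ 1` continuous), then the same holds with `γ̃_a − γ̃_b ∈ [α, β]`.
(`PairCount.tendsto_card_filter_Icc_div_of_close` with `eventually_close_logDiff_normalizedDiff`
and `eventually_card_smallPairs_le`.) [folklore] -/
theorem tendsto_card_normalizedBox_of_logBox {w : ℝ → ℝ} (hw : Continuous w)
    (hw0 : ∀ x, 0 ≤ w x) (hw1 : ∀ x, w x ≤ 1)
    (h : ∀ α β : ℝ, α < β → Tendsto (fun T : ℝ ↦
      ((((Finset.range (zetaZeroCount T)).offDiag).filter fun p : ℕ × ℕ ↦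
        (zetaOrdinate p.1 - zetaOrdinate p.2) * Real.log T / (2 * π) ∈ Set.Icc α β).card : ℝ) /
        zetaZeroCount T) atTop (𝓝 (∫ x in α..β, w x)))
    {α β : ℝ} (hαβ : α < β) :
    Tendsto (fun T : ℝ ↦
      ((((Finset.range (zetaZeroCount T)).offDiag).filter fun p : ℕ × ℕ ↦
        normalizedOrdinate p.1 - normalizedOrdinate p.2 ∈ Set.Icc α β).card : ℝ) /
        zetaZeroCount T) atTop (𝓝 (∫ x in α..β, w x)) :=
  PairCount.tendsto_card_filter_Icc_div_of_close
    (fun T ↦ (Finset.range (zetaZeroCount T)).offDiag) (fun T ↦ (zetaZeroCount T : ℝ))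
    eventually_natCast_zetaZeroCount_pos
    (fun T p ↦ (zetaOrdinate p.1 - zetaOrdinate p.2) * Real.log T / (2 * π))
    (fun _ p ↦ normalizedOrdinate p.1 - normalizedOrdinate p.2)
    (fun M T p ↦ min (zetaOrdinate p.1) (zetaOrdinate p.2) ≤ T / M)
    (fun _ hM _ hB _ hε ↦ eventually_close_logDiff_normalizedDiff hM hB hε)
    (fun _ hB hapr _ hε ↦ eventually_card_smallPairs_le hB hapr hε) hw hw0 hw1 h hαβ

/-- **Rudnick–Sarnak boxes ⇒ Montgomery boxes** (the converse exchange). [folklore] -/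
theorem tendsto_card_logBox_of_normalizedBox {w : ℝ → ℝ} (hw : Continuous w)
    (hw0 : ∀ x, 0 ≤ w x) (hw1 : ∀ x, w x ≤ 1)
    (h : ∀ α β : ℝ, α < β → Tendsto (fun T : ℝ ↦
      ((((Finset.range (zetaZeroCount T)).offDiag).filter fun p : ℕ × ℕ ↦
        normalizedOrdinate p.1 - normalizedOrdinate p.2 ∈ Set.Icc α β).card : ℝ) /
        zetaZeroCount T) atTop (𝓝 (∫ x in α..β, w x)))
    {α β : ℝ} (hαβ : α < β) :
    Tendsto (fun T : ℝ ↦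
      ((((Finset.range (zetaZeroCount T)).offDiag).filter fun p : ℕ × ℕ ↦
        (zetaOrdinate p.1 - zetaOrdinate p.2) * Real.log T / (2 * π) ∈ Set.Icc α β).card : ℝ) /
        zetaZeroCount T) atTop (𝓝 (∫ x in α..β, w x)) := by
  classical
  refine PairCount.tendsto_card_filter_Icc_div_of_close
    (fun T ↦ (Finset.range (zetaZeroCount T)).offDiag) (fun T ↦ (zetaZeroCount T : ℝ))
    eventually_natCast_zetaZeroCount_pos
    (fun _ p ↦ normalizedOrdinate p.1 - normalizedOrdinate p.2)
    (fun T p ↦ (zetaOrdinate p.1 - zetaOrdinate p.2) * Real.log T / (2 * π))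
    (fun M T p ↦ min (zetaOrdinate p.1) (zetaOrdinate p.2) ≤ T / M)
    (fun M hM B hB ε hε ↦ ?_) (fun B hB hapr ε hε ↦ ?_) hw hw0 hw1 h hαβ
  · filter_upwards [eventually_close_logDiff_normalizedDiff hM hB hε] with T hT p hp hsm hstat
    rw [abs_sub_comm]
    exact hT p hp hsm (Or.comm.1 hstat)
  · have hapr' : ∃ C : ℝ, ∀ᶠ T : ℝ in atTop,
        ((((Finset.range (zetaZeroCount T)).offDiag).filter fun p : ℕ × ℕ ↦
          |(zetaOrdinate p.1 - zetaOrdinate p.2) * Real.log T / (2 * π)| ≤ 2 * B ∧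
          |normalizedOrdinate p.1 - normalizedOrdinate p.2| ≤ 2 * B).card : ℝ) ≤
            C * zetaZeroCount T := by
      obtain ⟨C, hC⟩ := hapr
      refine ⟨C, ?_⟩
      filter_upwards [hC] with T hT
      rwa [Finset.filter_congr (fun p _ ↦ and_comm)]
    obtain ⟨M, hM, hev⟩ := eventually_card_smallPairs_le hB hapr' hε
    refine ⟨M, hM, ?_⟩
    filter_upwards [hev] with T hT
    rwa [Finset.filter_congr (fun p _ ↦ by rw [or_comm])]

/-- **Exchange of normalisations.** For a continuous weight `0 ≤ w ≤ 1`, the closed-box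
statistics of the off-diagonal pairs of zeta zeros converge to `∫_α^β w` for all `α < β` in
Montgomery's normalisation `(γ_a − γ_b) log T / 2π` (Montgomery 1973, (12)) iff they do so in
the normalisation `γ̃_a − γ̃_b`, `γ̃ = γ log γ / 2π` (Rudnick–Sarnak 1996, §1).
[folklore] -/
theorem tendsto_card_normalizedBox_iff_tendsto_card_logBox {w : ℝ → ℝ} (hw : Continuous w)
    (hw0 : ∀ x, 0 ≤ w x) (hw1 : ∀ x, w x ≤ 1) :
    (∀ α β : ℝ, α < β → Tendsto (fun T : ℝ ↦
      ((((Finset.range (zetaZeroCount T)).offDiag).filter fun p : ℕ × ℕ ↦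
        normalizedOrdinate p.1 - normalizedOrdinate p.2 ∈ Set.Icc α β).card : ℝ) /
        zetaZeroCount T) atTop (𝓝 (∫ x in α..β, w x))) ↔
    (∀ α β : ℝ, α < β → Tendsto (fun T : ℝ ↦
      ((((Finset.range (zetaZeroCount T)).offDiag).filter fun p : ℕ × ℕ ↦
        (zetaOrdinate p.1 - zetaOrdinate p.2) * Real.log T / (2 * π) ∈ Set.Icc α β).card : ℝ) /
        zetaZeroCount T) atTop (𝓝 (∫ x in α..β, w x))) :=
  ⟨fun h _ _ hαβ ↦ tendsto_card_logBox_of_normalizedBox hw hw0 hw1 h hαβ,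
    fun h _ _ hαβ ↦ tendsto_card_normalizedBox_of_logBox hw hw0 hw1 h hαβ⟩

end Literature.NumberTheory.LFunctions

end
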